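import Literature.MathematicalPhysics.QuantumFieldTheory.QCDPhaseQuenched
import Literature.MathematicalPhysics.QuantumLattice.WilsonDiracAP
import Literature.Probability.LatticeModels.TwoPointLogConvex
import HarnessLib

/-!
# Translation covariance of the `N_f`-flavour Wilson matrix and translation invariance of
phase-quenched quark-propagator moments

Topic `Literature/MathematicalPhysics/QuantumFieldTheory`; namespace
`Literature.MathematicalPhysics.QuantumFieldTheory`.

The torus translation `τ_v U (x, μ) = U(x − v, μ)` (tree `torusConfigShift`) reindexes the one-flavour
Wilson–Dirac operator by `(x, a, α) ↦ (x − v, a, α)` (tree `wilsonDirac_torusConfigShift`,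
`WilsonDiracAP.lean`).  Here the same is recorded for the flavour-diagonal `N_f`-flavour matrix
`diracMatrix` of `QCDOS.lean` (through the fixed enumeration `quarkEquiv`), for its determinant and
its inverse, and combined with the translation invariance of the Wilson measure
(`wilsonMeasure_map_torusConfigShift`) into the statement every finite-volume localisation
argument on the torus uses first ("the a-priori bound / the input at the origin holds at every
centre"): the `|det D|`-weighted Wilson integral of ANY functional of the quark propagator is
unchanged when both quark indices are translated by the same lattice vector.

* `quarkShift v` — the permutation of quark indices induced by `x ↦ x − v`;
* `diracMatrix_torusConfigShift`, `det_diracMatrix_torusConfigShift`,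
  `inv_diracMatrix_torusConfigShift(_apply)` — covariance of `D`, `det D`, `D⁻¹`;
* `integral_norm_det_smul_comp_inv_submatrix` — `∫ |det D(U)| • Φ(D(U)⁻¹ ∘ shift) dμ_W =
  ∫ |det D(U)| • Φ(D(U)⁻¹) dμ_W` for every `Φ` (no measurability needed: `τ_v` is a measurable
  equivalence preserving `μ_W`);
* `phaseQuenched_twoPoint_translate` — the two-point phase-quenched fractional moment of the routes
  (`Σ_{a,i,b,j} |G_f((x,a,i),(y,b,j))|` to the power `s`, divided by `∫ |det D| dμ_W`) depends on
  the integer sites `x, y ∈ ℤ⁴` only through `y − x`.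

Montvay–Münster 1994 §4.2 / §5.1 (translation invariance of the lattice action and measure);
Aizenman–Schenker–Friedrich–Hundertmark 2001 §2 (where the finite-volume criterion is moved from
the origin to an arbitrary centre).  Not here: reflections (see `WilsonDiracAP.lean`), the
infinite-volume limit.
-/

noncomputable section

open MeasureTheory
open Literature.MathematicalPhysics.QuantumLattice Literature.Probability.LatticeModels

namespace Literature.MathematicalPhysics.QuantumFieldTheory

variable {Nf L : ℕ} [NeZero L]

/-- The permutation of quark indices induced by the site translation `x ↦ x − v`:
`quarkShift v (quarkEquiv (f, (x, a, α))) = quarkEquiv (f, (x − v, a, α))`. [folklore] -/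
def quarkShift (v : TorusSite 4 L) : FermiIdx Nf L ≃ FermiIdx Nf L :=
  (quarkEquiv.symm.trans ((Equiv.refl (Fin Nf)).prodCongr
    ((Equiv.subRight v).prodCongr (Equiv.refl (Fin 3 × Fin 4))))).trans quarkEquiv

/-- `quarkShift` on an enumerated quark variable. [folklore] -/
@[simp] theorem quarkShift_quarkEquiv (v : TorusSite 4 L) (f : Fin Nf) (x : TorusSite 4 L)
    (c : Fin 3 × Fin 4) :
    quarkShift v (quarkEquiv (f, (x, c))) = quarkEquiv (f, (x - v, c)) := by
  simp [quarkShift]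

/-- Entries of `diracMatrix` on enumerated quark variables: flavour-diagonal with the one-flavour
Wilson operators as blocks. [cite: MontvayMunster1994, §5.1 (flavour-diagonal Wilson action)] -/
theorem diracMatrix_apply_quarkEquiv (U : GaugeConfig 4 L SU3) (mq : Fin Nf → ℝ) (f g : Fin Nf)
    (s t : TorusSite 4 L × Fin 3 × Fin 4) :
    diracMatrix U mq (quarkEquiv (f, s)) (quarkEquiv (g, t)) =
      if f = g then wilsonDirac (fundamentalRep (Fin 3)) U (mq f) 1 s t else 0 := by
  simp [diracMatrix]

/-- **Translation covariance of the `N_f`-flavour Wilson matrix**: `D[τ_v U]` is `D[U]` reindexed by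
`quarkShift v` on both sides. [folklore] -/
theorem diracMatrix_torusConfigShift (v : TorusSite 4 L) (U : GaugeConfig 4 L SU3) (mq : Fin Nf → ℝ) :
    diracMatrix (torusConfigShift v U) mq = (diracMatrix U mq).submatrix (quarkShift v) (quarkShift v) := by
  ext p q
  obtain ⟨⟨f, x, c⟩, rfl⟩ := quarkEquiv.surjective p
  obtain ⟨⟨g, y, d⟩, rfl⟩ := quarkEquiv.surjective q
  rw [Matrix.submatrix_apply, quarkShift_quarkEquiv, quarkShift_quarkEquiv,
    diracMatrix_apply_quarkEquiv, diracMatrix_apply_quarkEquiv, wilsonDirac_torusConfigShift]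
  rfl

/-- **Translation invariance of the `N_f`-flavour Wilson determinant.** [folklore] -/
theorem det_diracMatrix_torusConfigShift (v : TorusSite 4 L) (U : GaugeConfig 4 L SU3)
    (mq : Fin Nf → ℝ) :
    (diracMatrix (torusConfigShift v U) mq).det = (diracMatrix U mq).det := by
  rw [diracMatrix_torusConfigShift, Matrix.det_submatrix_equiv_self]

/-- **Translation covariance of the quark propagator** (including Mathlib's junk value `0` at
singular matrices, which is reindexed consistently). [folklore] -/
theorem inv_diracMatrix_torusConfigShift (v : TorusSite 4 L) (U : GaugeConfig 4 L SU3)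
    (mq : Fin Nf → ℝ) :
    (diracMatrix (torusConfigShift v U) mq)⁻¹ =
      (diracMatrix U mq)⁻¹.submatrix (quarkShift v) (quarkShift v) := by
  rw [diracMatrix_torusConfigShift, Matrix.inv_submatrix_equiv]

/-- Entrywise form of `inv_diracMatrix_torusConfigShift`: the propagator of the translated field
between `(f, x)` and `(g, y)` is the propagator of the field between `(f, x − v)` and `(g, y − v)`.
[folklore] -/
theorem inv_diracMatrix_torusConfigShift_apply (v : TorusSite 4 L) (U : GaugeConfig 4 L SU3)
    (mq : Fin Nf → ℝ) (f g : Fin Nf) (x y : TorusSite 4 L) (c d : Fin 3 × Fin 4) :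
    (diracMatrix (torusConfigShift v U) mq)⁻¹ (quarkEquiv (f, (x, c))) (quarkEquiv (g, (y, d))) =
      (diracMatrix U mq)⁻¹ (quarkEquiv (f, (x - v, c))) (quarkEquiv (g, (y - v, d))) := by
  rw [inv_diracMatrix_torusConfigShift, Matrix.submatrix_apply, quarkShift_quarkEquiv,
    quarkShift_quarkEquiv]

/-- **Translation invariance of `|det D|`-weighted Wilson integrals of propagator functionals**:
for every `Φ` on quark matrices and every lattice vector `v`,
`∫ |det D(U)| • Φ(D(U)⁻¹ reindexed by quarkShift v) dμ_W = ∫ |det D(U)| • Φ(D(U)⁻¹) dμ_W`.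
Proof: the integrand on the left is `U ↦ Ψ(τ_v U)` for `Ψ(U) = |det D(U)| • Φ(D(U)⁻¹)`
(`det_diracMatrix_torusConfigShift`, `inv_diracMatrix_torusConfigShift`), and `τ_v` is a measurable
equivalence preserving `μ_W` (`wilsonMeasure_map_torusConfigShift`, `integral_map_equiv`); no
measurability of `Φ` is needed. [folklore] -/
theorem integral_norm_det_smul_comp_inv_submatrix {E : Type*} [NormedAddCommGroup E]
    [NormedSpace ℝ E] (β : ℝ) (mq : Fin Nf → ℝ) (v : TorusSite 4 L)
    (Φ : Matrix (FermiIdx Nf L) (FermiIdx Nf L) ℂ → E) :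
    ∫ U, ‖(diracMatrix U mq).det‖ • Φ ((diracMatrix U mq)⁻¹.submatrix (quarkShift v) (quarkShift v))
        ∂(wilsonMeasure (d := 4) (L := L) (fundamentalRep (Fin 3)) β) =
      ∫ U, ‖(diracMatrix U mq).det‖ • Φ (diracMatrix U mq)⁻¹
        ∂(wilsonMeasure (d := 4) (L := L) (fundamentalRep (Fin 3)) β) := by
  have h : ∀ U : GaugeConfig 4 L SU3,
      ‖(diracMatrix U mq).det‖ • Φ ((diracMatrix U mq)⁻¹.submatrix (quarkShift v) (quarkShift v)) =
        ‖(diracMatrix (torusConfigShift v U) mq).det‖ • Φ (diracMatrix (torusConfigShift v U) mq)⁻¹ :=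
    fun U => by rw [det_diracMatrix_torusConfigShift, inv_diracMatrix_torusConfigShift]
  simp_rw [h]
  rw [← integral_map_equiv (torusConfigShift (G := SU3) v)
    (fun U => ‖(diracMatrix U mq).det‖ • Φ (diracMatrix U mq)⁻¹),
    wilsonMeasure_map_torusConfigShift]

/-- **Phase-quenched two-point moments depend only on the difference of the sites.**  For the
quantity of the QCD routes — the `|det D|`-reweighted Wilson integral of
`(Σ_{a,i,b,j} |G_f((x,a,i),(y,b,j))|)^s` on the torus of side `L`, read at the projections of
integer sites `x, y ∈ ℤ⁴` — translating both sites by `w ∈ ℤ⁴` changes nothing (numerator and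
denominator separately; the denominator does not see the sites at all). [folklore] -/
theorem phaseQuenched_twoPoint_translate (β : ℝ) (mq : Fin Nf → ℝ) (f : Fin Nf) (s : ℝ)
    (x y w : Literature.Probability.LatticeModels.Site 4) :
    (∫ U : GaugeConfig 4 L SU3, ‖(diracMatrix U mq).det‖ *
        (∑ a : Fin 3, ∑ i : Fin 4, ∑ b : Fin 3, ∑ j : Fin 4,
          ‖(diracMatrix U mq)⁻¹ (quarkEquiv (f, (Torus.proj L (x + w), a, i)))
            (quarkEquiv (f, (Torus.proj L (y + w), b, j)))‖) ^ s
        ∂(wilsonMeasure (fundamentalRep (Fin 3)) β)) =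
      ∫ U : GaugeConfig 4 L SU3, ‖(diracMatrix U mq).det‖ *
        (∑ a : Fin 3, ∑ i : Fin 4, ∑ b : Fin 3, ∑ j : Fin 4,
          ‖(diracMatrix U mq)⁻¹ (quarkEquiv (f, (Torus.proj L x, a, i)))
            (quarkEquiv (f, (Torus.proj L y, b, j)))‖) ^ s
        ∂(wilsonMeasure (fundamentalRep (Fin 3)) β) := by
  -- the functional `Φ(G) = (Σ |G((f,x,·),(f,y,·))|)^s`, translated by `v = -proj w`
  have h := integral_norm_det_smul_comp_inv_submatrix (L := L) β mq (-Torus.proj L w)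
    (fun G : Matrix (FermiIdx Nf L) (FermiIdx Nf L) ℂ =>
      (∑ a : Fin 3, ∑ i : Fin 4, ∑ b : Fin 3, ∑ j : Fin 4,
        ‖G (quarkEquiv (f, (Torus.proj L x, a, i))) (quarkEquiv (f, (Torus.proj L y, b, j)))‖) ^ s)
  simp only [smul_eq_mul, Matrix.submatrix_apply, quarkShift_quarkEquiv, sub_neg_eq_add,
    ← Torus.proj_add] at h
  exact h

end Literature.MathematicalPhysics.QuantumFieldTheory

end
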